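import Summits.CriticalPhenomena.SAWScalingLimit.Theorems.SAWRenewalTightnessTubeLowerBoundProfilePotentialDefs
import Summits.CriticalPhenomena.SAWScalingLimit.Theorems.SAWRenewalTightnessTubeLowerBoundQuadrantCut
import Summits.CriticalPhenomena.SAWScalingLimit.Theorems.SAWRenewalTightnessTubeLowerBoundCornerFloorOfCut
import Summits.CriticalPhenomena.SAWScalingLimit.Theorems.SAWRenewalTightnessTubeLowerBoundHalfPlaneCut
import Summits.CriticalPhenomena.SAWScalingLimit.Theorems.SAWRenewalTightnessTubeLowerBoundSpanFloorOfHalfPlaneCut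
import Summits.CriticalPhenomena.SAWScalingLimit.Theorems.SAWRenewalTightnessTubeLowerBoundSteeredChain
import Summits.CriticalPhenomena.SAWScalingLimit.Theorems.SAWRenewalTightnessTubeLowerBoundMirrorPin
import Summits.CriticalPhenomena.SAWScalingLimit.Theorems.SAWRenewalTightnessTubeLowerBoundCornerStaircase
import Summits.CriticalPhenomena.SAWScalingLimit.Theorems.SAWRenewalTightnessTubeLowerBoundOctantReduction
import Summits.CriticalPhenomena.SAWScalingLimit.Theorems.TubeLowerBound.Negative.TubeLowerBoundLoadBearing
import Summits.CriticalPhenomena.SAWScalingLimit.Theorems.TubeLowerBound.Negative.TubeLowerBoundFixedWidth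
import Summits.CriticalPhenomena.SAWScalingLimit.Theorems.AnnularMassDecay.Negative.HalfPlaneDivergence
import Literature.Probability.RandomPlanarGeometry.SAWBridges

/-!
# Line `profile-potential` — skeleton for the crux `SAWRenewalTightness.TubeLowerBound`
(crux item stmt-CriticalPhenomena-4730, rank 4 of `route-CriticalPhenomena-SAWRenewalTightness`; crux-plan round 2,
planner-cruxplan-stmt-CriticalPhenomena-4730-profile-potential-0, 2026-08-16; idea card
`Cruxes/TubeLowerBound/Ideas/profile-potential.md` (ideator 4, sketch `Cruxes/TubeLowerBound/ProfilePotentialSketch.lean`);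
triage r2-1: pass, r2-2: pass — sharpenings answered in `Lines/profile-potential.md`.)

LEAD RESHAPE (lead a1, prover-line-stmt-CriticalPhenomena-4730-a1-0, 2026-08-16): the objects and statements of the line
(`quadWalks`, `squareWalks`, `cornerExitEast`, `QuadrantCut`, `QuadrantDivergence`, `QuadrantProfileBound`, `CountProfileBound`,
`hpWalks`, `slabWalks`, `wallBridges`, `HalfPlaneCut`, `SlabSubcritical`, `HalfPlaneProfileBound`, `SpanRenewalFloor`) and the proved
upgrade `quadrantProfileBound_of_count` now live in the LANDED
`Theorems/SAWRenewalTightnessTubeLowerBoundProfilePotentialDefs.lean` (p130472, namespace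
`…Theorems.TubeLowerBound.ProfilePotential`, opened below) — verbatim the planner's texts — so that every stub file proves its
registered signature by name; the six registered stubs and the composition are unchanged.

Crux (FIXED, by name): `TubeLowerBound` — there are `C` and `c > 0` such that for all `u v ∈ ℤ²` and `ℓ ≥ 1` with
`|u − v| ≤ ℓ` some partial sum of the `x_c`-mass of self-avoiding walks `u → v` whose vertices stay within `ℓ/10 + 2`
of the segment `[u, v]` is `≥ c ℓ^{−C}`.

## The line (6 registered stubs; `TubeLowerBound_of` is kernel-checked glue over S1–S4 and the LANDED chain of
`lieb-simon-star`; S5–S6 give the by-product door `spanRenewalFloor_door` to the common milestone of all round-1 lines)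

The idea: run the Simon–Lieb / Hammersley first-exit cut not in `ℤ²` but INSIDE THE QUADRANT `Q = {x ≥ 0, y ≥ 0}` from
its corner `0`, with the closed square `[0,R]²` as inner set.  The near sides of the square are walls, so a corner walk
leaves the square only through the far east column `x = R+1` or the far north row `y = R+1`, and the diagonal reflection
`(x,y) ↦ (y,x)` (a lattice map preserving `Q`, `Zd.saws` and the corner) makes the two exit classes equinumerous.  Length
by length this is the fugacity-free CUT INEQUALITY (S1)
  `q_n ≤ s_n + 2 Σ_{k ≤ n} e_k · q^{(R+1)}_{n−k}`,
`q_n = #quadWalks 0 n` (corner walks), `s_n = #squareWalks R n`, `e_k = #cornerExitEast R k` (east first-exit prefixes),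
`q^{(a)}_m = #quadWalks a m` (walks from `0` staying in the quadrant cornered at `(−a,−a)`, which contains every
translated suffix).  Summing with weights `x_c^n` over `n ≤ N` and exchanging the sums:
  `P_N ≤ C_S + 2 Θ · P^{(R+1)}_N`,   `P^{(a)}_N := Σ_{n≤N} q^{(a)}_n x_c^n`,  `Θ := Σ_k e_k x_c^k`,  `C_S := Σ_{n<(R+1)²} c_n x_c^n`.
Two inputs of a NEW TYPE then force a floor on `Θ`: (S2) `QuadrantDivergence` — `P_N → ∞` (the critical corner
susceptibility of the quadrant is infinite; qualitative, predicted `q_n x_c^n ≍ n^{γ(π/2)−1}`, `γ(π/2) = 31/64 > 0`), and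
(S3) `QuadrantProfileBound` — the RATIO CEILING `P^{(R+1)}_N ≤ A (R+2)^C P_N` for all large `N` (moving the corner
diagonally away by `R+1` multiplies the critical quadrant susceptibility by at most a polynomial; predicted `≍ R^{55/48}`).
Indeed `P_N ≤ C_S + 2Θ A (R+2)^C P_N` with `P_N ≥ 2 C_S` gives `Θ ≥ 1/(4A) · (R+2)^{−C}`, and the east first-exit
prefixes are members of `CornerCrossingFloor`'s family at width `a = R+1`, aspect `K = 1` (S4).  From `CornerCrossingFloor`
the crux follows BY NAME through the landed `stub_steeredChain → stub_mirrorPin → stub_cornerStaircase →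
stub_octantReduction → tightTubeFloor_iff_crux` (Theorems/SAWRenewalTightnessTubeLowerBound{SteeredChain,MirrorPin,
CornerStaircase,OctantReduction,Defs}.lean).

* S1 `stub_quadrantCut` (provable now, M): the cut inequality `QuadrantCut`, length by length (first exit of `[0,R]²`,
  diagonal mirror, prefix/suffix as in `LiebSimon.count_le_cut`).
* S2 `stub_quadrantDivergence` (OPEN — conjecture-grade, triage r2-1/r2-2): `QuadrantDivergence`.
* S3 `stub_quadrantProfileBound` (OPEN — conjecture-grade, HARDEST): `QuadrantProfileBound`, the ratio ceiling in the
  partial-sum form at `x_c` (the weakest form the glue consumes; the fugacity-free count form `CountProfileBound` of the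
  card implies it under S2 — PROVED below, `quadrantProfileBound_of_count`).
* S4 `stub_cornerFloor_of_cut` (provable now, M): `QuadrantCut → QuadrantDivergence → QuadrantProfileBound →
  CornerCrossingFloor` (sum the cut, exchange, divide by the divergent corner susceptibility; filter inclusion into the
  `K = 1` family).
* S5 `stub_halfPlaneCut` (provable now, M) and S6 `stub_spanFloor_of_halfPlaneCut` (provable now, M): the same lever in the
  half-plane `{x ≥ 0}` from a wall point with the slab `[0,R] × ℤ` as inner set (ONE exit class, no symmetry needed) gives
  the by-product door `spanRenewalFloor_door : SlabSubcritical → HalfPlaneProfileBound → SpanRenewalFloor` (Kesten's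
  span-renewal floor, vertex form of p121181, the common milestone of the round-1 lines) from ONE half-plane ratio ceiling
  plus the classical slab subcriticality; its divergence input is the tree's
  `AnnularMassDecay.Negative.halfPlanePartialSum_unbounded` (triage r2-2 sharpening (1)).  Not consumed by
  `TubeLowerBound_of`.

Every statement is over TREE VOCABULARY (`Zd.saws`, `Zd.bridges`, `criticalFugacity`) plus the local `def`s of this
file; all series appear as PARTIAL SUMS (`∃ N` / `∀ N ≥ N₀`), no `HasSum`/`tsum` (triage r2-2 sharpening (2)); every floor
carries `0 ≤ C`.

Disproof.lean (cdisprove cycles 1–2; landed `Theorems/TubeLowerBound/Negative/TubeLowerBoundLoadBearing|FixedWidth|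
SubcriticalRenewalFloorTargets`, the first two IMPORTED here) honoured: `not_atFugacity_of_lt` (criticality load-bearing)
— H = "x = x_c" is used at S2 only: at `x < x_c` the corner susceptibility is finite and the summed cut forces nothing;
`not_withoutDist` (the tube must widen) — the inner square is `[0,a−1]²` at width `a`, and downstream the landed chain
keeps every box proportional to its span; `not_allN` — `∃ N` / eventually-in-`N` partial sums throughout; `constraints`
(`0 ≤ C`, `c ≤ 1`: here `Θ ≤ 1/2` by the reverse cut); `not_withoutSlack` — inherited from the landed composition;
`twoPoint_floor` — consistent (the output is such a floor); cycle 2 `tightTubeFloor_iff` — used as the last step of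
`TubeLowerBound_of`; `coneBridgeFloor_kappa_le` — not instantiated (no cone).  No stub is an instance of a refuted variant
(`example`s at the end record the landed Negative modules the stubs were checked against);
`ledger negatives --problem CriticalPhenomena` (10 items): nothing on susceptibility ratios, corner susceptibilities or cut
inequalities.
-/

noncomputable section

namespace Summit.CriticalPhenomena.SAWScalingLimit.Cruxes.TubeLowerBound.ProfilePotential

open scoped BigOperators Classical
open Literature.Probability.LatticeModels
open Literature.Probability.RandomPlanarGeometry Literature.Probability.RandomPlanarGeometry.SAW
open Summit.CriticalPhenomena.SAWScalingLimit.Theses.SAWRenewalTightness (TubeLowerBound)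
open Summit.CriticalPhenomena.SAWScalingLimit.Theorems.TubeLowerBound.LiebSimonStar
open Summit.CriticalPhenomena.SAWScalingLimit.Theorems.TubeLowerBound.ProfilePotential

set_option linter.unusedVariables false

/-! ## Registered stubs (`sorry` only here) -/

/-- **S1 `stub_quadrantCut`** — `QuadrantCut` (provable now, M).  Route: as `LiebSimon.count_le_cut`
(Theorems/…QuarterFlux.lean) — `k := Nat.find` of "`ω i ∉ [0,R]²` or `n ≤ i`"; if the walk never leaves it lies in
`squareWalks R n`; otherwise one lattice step from inside `[0,R]²` within `Q` lands on `x = R+1` (height `≤ R`) or on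
`y = R+1` (abscissa `≤ R`), never both; prefix `fun i => ω (min i k)` (`LiebSimon.prefix_mem_saws`) is in `cornerExitEast R k`
or in its image under the transposition `(x,y) ↦ (y,x)` (`Literature.Probability.Percolation.transposeIso`, transport as in
`LiebSimon.card_filter_le_east`: same cardinality); suffix `fun j => ω (k + min j (n−k)) − ω k` (`LiebSimon.suffix_mem_saws`)
lies in `quadWalks (R+1) (n−k)`; injectivity exactly as in `count_le_cut`; conclude with `Finset.card_le_card_of_injOn` into
`squareWalks R n ⊕ Σ_k (E_k ⊕ N_k) × quadWalks (R+1) (n−k)` and `card N_k = card E_k`. -/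
theorem stub_quadrantCut : QuadrantCut :=
  Summit.CriticalPhenomena.SAWScalingLimit.Theorems.TubeLowerBound.ProfilePotential.stub_quadrantCut  -- LANDED p131072

/-- **S2 `stub_quadrantDivergence`** — `QuadrantDivergence` (OPEN, conjecture-grade; an exponent inequality
"`γ(π/2) ≥ 0`"-type for the 90° wedge).  In print only the GROWTH CONSTANT of wedge walks is known to equal `μ`
(Hammersley–Whittington 1985; Madras–Slade Thm 8.2.3; Janse van Rensburg 2015 Cor. 6.48); the soft Hammersley–Welsh cut
that proves the half-plane analogue (`halfPlanePartialSum_unbounded`, in tree) produces wall-started or shifted-quadrant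
pieces, never corner-started ones (triage r2-1/r2-2).  Accepts subsequential / density-positive inputs (a divergent
sub-series suffices).  Cheapest falsifier: none finite; a proof that the critical corner susceptibility is finite kills the
line. -/
theorem stub_quadrantDivergence : QuadrantDivergence := by
  sorry

/-- **S3 `stub_quadrantProfileBound`** — `QuadrantProfileBound` (OPEN, conjecture-grade; the HARDEST stub: a
corner-crossover RATIO CEILING `ρ^Q(R) ≲ R^{55/48}`, the ceiling twin of the boundary-regime floors; no technique in print —
relocating the corner by a multi-valued map runs into the walk's unboundedly many visits to the L-shaped margin
`Q ∖ ((R+1,R+1) + Q)`, whose last-exit decomposition lands on WALL-started pieces (triage r2-1 sharpen, r2-2 (iv)(2)).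
Structural conveniences (triage-validated): monotone in the corner shift, so a polynomially sparse set of scales `R_j`
suffices (exponent `C·K` if `R_{j+1} ≤ R_j^K`); `N₀(R)` free; paid ONCE in the composition.  Admissible stronger
replacement: `CountProfileBound` (count form, `quadrantProfileBound_of_count`).  Cheapest falsifier: super-polynomial growth
in `t` of `sup_n q_n^{(t,t)}/q_n^{(0,0)}` in exact enumeration (kit j019970 / j020109 tables, `t ≤ 10`) — against
Cardy/Duplantier–Saleur; nothing finite refutes the `∃ A C` statement. -/
theorem stub_quadrantProfileBound : QuadrantProfileBound := by
  sorry

/-- **S4 `stub_cornerFloor_of_cut`** — `QuadrantCut → QuadrantDivergence → QuadrantProfileBound → CornerCrossingFloor`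
(provable now, M; pure finite-sum calculus, no `HasSum`).  Fix `(A, C)` from the profile bound; output `K = 1`, exponent
`C`, constant `c = 1/(4A·2^C)`.  Given `a ≥ 1` put `R = a − 1`.  (1) Multiply the cut at length `n` by `x_c^n = x_c^k
x_c^{n−k}`, sum over `n ≤ N` and exchange (`Finset.sum_sigma'` / `Finset.sum_comm` on the triangle `k ≤ n ≤ N`, cf.
`AnnularMassDecay.Negative.triangle_sum_le`): `P_N ≤ SQ_N + 2 Θ_N P'_N` with `P_N = Σ_{n≤N} q_n x_c^n`,
`P'_N = Σ_{n≤N} q^{(R+1)}_n x_c^n` (partial sums are monotone, terms nonnegative), `Θ_N = Σ_{k≤N} e_k x_c^k`,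
`SQ_N = Σ_{n≤N} s_n x_c^n`.  (2) `SQ_N ≤ C_S := Σ_{n<(R+1)²} c_n x_c^n` since `squareWalks R n = ∅` for `n ≥ (R+1)²`
(an injective `ω` on `[0,n]` into the `(R+1)²` sites of the square; `Finset.card_le_card_of_injOn` into
`Finset.Icc 0 R ×ˢ Finset.Icc 0 R` transported to `Site 2`) and `s_n ≤ c_n` (`Zd.card_saws`).  (3) Take `N ≥ N₀(R)` with
`P_N ≥ 2 C_S + 2` (S2 and monotonicity of `P`): `P_N ≤ C_S + 2 Θ_N A (R+2)^C P_N` gives `Θ_N ≥ (1 − C_S/P_N)/(2A(R+2)^C) ≥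
1/(4A (R+2)^C) ≥ c a^{−C}` using `R + 2 = a + 1 ≤ 2a` and `Real.rpow_natCast` bookkeeping.  (4) `cornerExitEast R k ⊆`
the filter of `CornerCrossingFloor` at `a = R+1`, `K = 1` (for `i < k` the square bounds, for `i = k` the three end
conjuncts; `(1 : ℤ) * a = a`), and `Σ_{ω ∈ F} x_c^k = card F · x_c^k` (`Finset.sum_const`, `nsmul_eq_mul`), so `Θ_N` is at
most the `CornerCrossingFloor` double sum at the same `N`. -/
theorem stub_cornerFloor_of_cut :
    QuadrantCut → QuadrantDivergence → QuadrantProfileBound → CornerCrossingFloor :=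
  Summit.CriticalPhenomena.SAWScalingLimit.Theorems.TubeLowerBound.ProfilePotential.stub_cornerFloor_of_cut  -- LANDED p130961

/-- **S5 `stub_halfPlaneCut`** — `HalfPlaneCut` (provable now, M; by-product side).  As S1 with `k := Nat.find` of
"`ω i 0 = R+1` or `n ≤ i`": a weak half-plane walk from `0` has `x ≥ 0` throughout, so before `k` it lies in the slab
`[0,R]`, the prefix is in `wallBridges R k`, the suffix translated to `0` has `x ≥ −(R+1)`; no second exit class. -/
theorem stub_halfPlaneCut : HalfPlaneCut :=
  Summit.CriticalPhenomena.SAWScalingLimit.Theorems.TubeLowerBound.ProfilePotential.stub_halfPlaneCut  -- LANDED p130821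

/-- **S6 `stub_spanFloor_of_halfPlaneCut`** — `HalfPlaneCut → SlabSubcritical → HalfPlaneProfileBound → SpanRenewalFloor`
(provable now, M; by-product side).  (1) Sum the cut with weights `x_c^n` over `n ≤ N` and exchange:
`H_N ≤ SL_N + W_N H'_N` with `H_N = Σ_{n≤N} h̃_n x_c^n`, `H'_N` the depth-`(R+1)` partial sum, `W_N = Σ_{k≤N} w_k x_c^k`,
`SL_N ≤ S(R)` (slab subcriticality).  (2) DIVERGENCE is in tree: `Zd.halfSpaceWalks 2 n ⊆ hpWalks 0 n` (a strict half-space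
walk from `0` has `x ≥ 0`), so `H_N ≥ halfPlanePartialSum N → ∞`
(`AnnularMassDecay.Negative.halfPlanePartialSum_unbounded`).  (3) With the profile bound at `t = R+1` and `N ≥ N₀` such that
`H_N ≥ 2 S(R)`: `W_N ≥ 1/(2A (R+2)^C)`.  (4) Prepend one east step: `ω ↦ Zd.concatWalk 1 (Zd.straightWalk 2 1) ω`-type map
(or by hand `fun i => if i = 0 then 0 else e₁ + ω (i−1)`) sends `wallBridges R k` injectively into
`{β ∈ Zd.bridges 2 (k+1) | β (k+1) 0 = R+2}` (`Zd.mem_bridges`, `Zd.IsBridge`: `0 < 1 ≤ x ≤ R+1 < R+2` at interior times),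
so `x_c W_N ≤` the `SpanRenewalFloor` double sum at `L = R+2`, cut-off `N+1`; this covers every `L ≥ 2` with
`c = x_c/(2A)`, exponent `C` (`(R+2)^{−C} = L^{−C}`); `L = 1`: the one-step bridge, mass `x_c ≥ c`
(`Zd.one_le_bridgeCount`-style witness `Zd.straightWalk 2 1`). -/
theorem stub_spanFloor_of_halfPlaneCut :
    HalfPlaneCut → SlabSubcritical → HalfPlaneProfileBound → SpanRenewalFloor :=
  Summit.CriticalPhenomena.SAWScalingLimit.Theorems.TubeLowerBound.ProfilePotential.stub_spanFloor_of_halfPlaneCut  -- LANDED p131154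

/-! ## Proved glue -/

/-- The count form of S3 is an admissible replacement (LANDED with the Defs, p130472, registered sub-goal
`quadrantProfileBound_of_count`): a worker who proves `CountProfileBound` gets S3 from it and S2. -/
example : QuadrantDivergence → CountProfileBound → QuadrantProfileBound := quadrantProfileBound_of_count

/-- `0 ≤ x_c`. [folklore] -/
theorem criticalFugacity_nonneg : 0 ≤ criticalFugacity := criticalFugacity_pos.le

/-- Partial sums of the corner series are `≥ 1` (the `n = 0` term: the zero-step walk is a corner walk). [folklore] -/
theorem one_le_quadPartialSum (a N : ℕ) :
    1 ≤ ∑ n ∈ Finset.range (N + 1), ((quadWalks a n).card : ℝ) * criticalFugacity ^ n := by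
  have h0 : (1 : ℝ) ≤ ((quadWalks a 0).card : ℝ) * criticalFugacity ^ 0 := by
    rw [pow_zero, mul_one, Nat.one_le_cast, Finset.one_le_card]
    refine ⟨fun _ => 0, ?_⟩
    rw [quadWalks, Finset.mem_filter]
    refine ⟨Zd.mem_saws.2 ⟨rfl, fun i _ => rfl, fun i hi => (Nat.not_lt_zero i hi).elim, ?_⟩, fun i _ => ?_⟩
    · intro i hi j hj _
      simp only [Set.mem_setOf_eq, Nat.le_zero] at hi hj
      rw [hi, hj]
    · simp
  calc (1 : ℝ) ≤ ((quadWalks a 0).card : ℝ) * criticalFugacity ^ 0 := h0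
    _ ≤ ∑ n ∈ Finset.range (N + 1), ((quadWalks a n).card : ℝ) * criticalFugacity ^ n :=
        Finset.single_le_sum (f := fun n => ((quadWalks a n).card : ℝ) * criticalFugacity ^ n)
          (fun n _ => mul_nonneg (Nat.cast_nonneg _) (pow_nonneg criticalFugacity_nonneg n))
          (Finset.mem_range.2 (Nat.succ_pos N))

/-! ## The composition: S1–S4 give `CornerCrossingFloor`, the landed `lieb-simon-star` chain gives the crux BY NAME -/

/-- `CornerCrossingFloor` (the single open stub of the landed line `lieb-simon-star`, with `K = 1`) from the four
quadrant stubs. -/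
theorem cornerCrossingFloor_of_line : CornerCrossingFloor :=
  stub_cornerFloor_of_cut stub_quadrantCut stub_quadrantDivergence stub_quadrantProfileBound

/-- `TightTubeFloor` by the LANDED chain `stub_steeredChain → stub_mirrorPin → stub_cornerStaircase →
stub_octantReduction` (Theorems/SAWRenewalTightnessTubeLowerBound{SteeredChain,MirrorPin,CornerStaircase,
OctantReduction}.lean). -/
theorem tightTubeFloor_of_line : TightTubeFloor :=
  stub_octantReduction (stub_cornerStaircase (stub_mirrorPin (stub_steeredChain cornerCrossingFloor_of_line)))

/-- **`TubeLowerBound` from the line `profile-potential`** (kernel-checked, no `sorry` of its own): the quadrant cut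
(S1), the divergence of the critical corner susceptibility (S2) and the susceptibility-profile ratio ceiling (S3) give the
corner-crossing floor (S4), which the landed `lieb-simon-star` chain turns into `TightTubeFloor`, `↔` the crux by the
landed `tightTubeFloor_iff_crux` (Defs p76932 / `Negative.tightTubeFloor_iff`). -/
theorem TubeLowerBound_of : TubeLowerBound :=
  tightTubeFloor_iff_crux.1 tightTubeFloor_of_line

/-! ## By-product door (S5–S6): the milestone `SpanRenewalFloor` from ONE half-plane ratio ceiling -/

/-- **`spanRenewalFloor_door`**: Kesten's span-renewal floor (vertex form, the common milestone of the round-1 lines)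
follows from slab subcriticality (classical) and the half-plane profile bound (V1b) — the half-plane cut S5 and the glue
S6; the divergence input is the tree's `halfPlanePartialSum_unbounded`.  Not consumed by `TubeLowerBound_of`. -/
theorem spanRenewalFloor_door : SlabSubcritical → HalfPlaneProfileBound → SpanRenewalFloor :=
  stub_spanFloor_of_halfPlaneCut stub_halfPlaneCut

/-! ## Negative knowledge checked against (landed `Theorems/TubeLowerBound/Negative/*`, imported above) -/

/-- Criticality is load-bearing (`not_atFugacity_of_lt`): the crux at any fugacity `x ∈ [0, x_c)` is FALSE.  The line
uses `x = x_c` at S2 only (S1, S4–S6 are fugacity-free or valid at every `x ≥ 0`; at `x < x_c` the corner susceptibility is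
finite and the summed cut forces nothing). -/
example {x : ℝ} (hx0 : 0 ≤ x) (hx : x < criticalFugacity) :
    ¬ (∃ C c : ℝ, 0 < c ∧ ∀ (u v : Site 2) (ℓ : ℝ), 1 ≤ ℓ →
      dist (Site.toComplex u) (Site.toComplex v) ≤ ℓ →
        ∃ N : ℕ, c * ℓ ^ (-C) ≤
          Summit.CriticalPhenomena.SAWScalingLimit.Theorems.TubeLowerBound.Negative.tubeMass x u v (ℓ / 10 + 2) N) :=
  Summit.CriticalPhenomena.SAWScalingLimit.Theorems.TubeLowerBound.Negative.not_atFugacity_of_lt hx0 hx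

/-- The refuted FIXED-WIDTH variant (`not_withoutDist`): the square `[0,a−1]²` of S1/S4 and every box downstream widen
linearly with the span, so no stub is an instance. -/
example : ¬ (∃ C c : ℝ, 0 < c ∧ ∀ (u v : Site 2) (ℓ : ℝ), 1 ≤ ℓ →
    ∃ N : ℕ, c * ℓ ^ (-C) ≤
      Summit.CriticalPhenomena.SAWScalingLimit.Theorems.TubeLowerBound.Negative.tubeMass
        criticalFugacity u v (ℓ / 10 + 2) N) :=
  Summit.CriticalPhenomena.SAWScalingLimit.Theorems.TubeLowerBound.Negative.not_withoutDist

/-- The half-plane divergence input of S6 is a theorem of the tree. -/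
example : ∀ B : ℝ, ∃ K,
    B < Summit.CriticalPhenomena.SAWScalingLimit.Theorems.AnnularMassDecay.Negative.halfPlanePartialSum K :=
  Summit.CriticalPhenomena.SAWScalingLimit.Theorems.AnnularMassDecay.Negative.halfPlanePartialSum_unbounded

end Summit.CriticalPhenomena.SAWScalingLimit.Cruxes.TubeLowerBound.ProfilePotential

end
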